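import Summits.MatrixMultiplication.OmegaCensus.SmallFormats.MatMul227GF3EnumSymmetry
import HarnessLib

/-!
# ω-census family (a): kernel `(henum)` at `(7,23)` — symmetry reductions and the enumeration of count vectors

Cell `pub-omega` (unit `pub-omega-tensor`, gen 31), topic `Summits/MatrixMultiplication/OmegaCensus`
(sub-folder `SmallFormats`). Framing (verbatim): lottery ticket; floor = certified bounds/negative ranges.
HONEST FRAMING: bookkeeping — part 10 of 12 of the KERNEL proof of the ENUMERATION hypothesis `(henum)` of
`twentyfour_le_tensorRank_227_gf3_of_enumeration` (`MatMul22nGF3MarginalCensus`) for the six-orbit list of the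
`𝔽₃` `⟨2,2,7⟩@23` X-marginal census (desk-certified ×3 before: ENUM-X2 §6/§8). The EXCLUSION hypothesis `(hexcl)`
stays engine-side (Pa17: two code-disjoint exact engines; the IP instrument); nothing here is a bound on `ω`, and no
sentence here is 'R_𝔽₃(⟨2,2,7⟩) ≥ 24'.

The WLOG chain on count vectors — translate an invertible class to `I`; no invertible class occurs twice (case
`I`); conjugate the second class to `κ₀ / γ₀ / τ₀` (cases `kappa` = four sub-cases, `gamma`, `tau`); only double
transpositions left ⇒ `b ≤ 4 < 7` — and the assembled theorem `enum_of_runs`: given the kernel searches, every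
admissible count vector is a word image of one of the three representatives.
-/

namespace Summit.MatrixMultiplication.OmegaCensus.SmallFormats.Enum723
set_option maxRecDepth 4000

open Finset

/-! ## The WLOG reductions and the case split -/

/-- An admissible count vector has an invertible class. -/
theorem exists_inv_pos {c : ℕ → ℕ} (h : Adm c) : ∃ a₀, a₀ < 24 ∧ 1 ≤ c a₀ := by
  by_contra hne
  push Not at hne
  have : bcnt c = 0 := Finset.sum_eq_zero fun a ha => by
    have := hne a (Finset.mem_range.mp ha); omega
  have := (window c h).1; omega

/-- The translation words: `wTransL[a₀]` moves class `a₀` to class `0`. -/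
theorem wTrans_fact : ∀ a₀, a₀ < 24 → srcW (wTransL.getD a₀ []) 0 = a₀ ∧ ∀ s ∈ wTransL.getD a₀ [], s < 5 := by
  decide

/-- Digit-bound tables of case `I`. -/
theorem bounds_I : ∀ b, b < 40 → lo_I.getD b 0 = (if b = 0 then 2 else 0) ∧ hi_I.getD b 0 = 2 := by decide

/-- The upper-bound tables have 40 entries. -/
theorem hi_lengths : hi_I.length = 40 ∧ hi_kappa.length = 40 ∧ hi_gamma.length = 40 ∧ hi_tau.length = 40 := by
  decide

/-- **No invertible class occurs twice** (case `I` of the search is empty). -/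
theorem no_two (hrun : runCase lo_I hi_I certs_I = true) {c : ℕ → ℕ} (h : Adm c) :
    ∀ a, a < 24 → c a ≤ 1 := by
  intro a₀ ha₀
  by_contra h2
  have h2' : c a₀ = 2 := by have := h.2.1 a₀ (by omega); omega
  obtain ⟨hsrc, hw⟩ := wTrans_fact a₀ ha₀
  set c₁ := actWS (wTransL.getD a₀ []) c with hc₁
  have hadm : Adm c₁ := adm_actWS _ hw h
  have h0 : c₁ 0 = 2 := by rw [hc₁, actWS_apply, hsrc, h2']
  have hB : InB lo_I hi_I c₁ := fun b hb => by
    obtain ⟨hl, hh⟩ := bounds_I b hb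
    rw [hl, hh]
    refine ⟨?_, hadm.2.1 b hb⟩
    split_ifs with hb0
    · rw [hb0, h0]
    · exact Nat.zero_le _
  obtain ⟨e, he, -⟩ := runCase_sound certs_I hi_lengths.1 hrun c₁ hadm hB
  simp [certs_I] at he

/-- After a translation: class `0` present exactly once. -/
theorem exists_translate (hrun : runCase lo_I hi_I certs_I = true) {c : ℕ → ℕ} (h : Adm c) :
    ∃ w, WordOK w ∧ actWS w c 0 = 1 := by
  obtain ⟨a₀, ha₀, h1⟩ := exists_inv_pos h
  obtain ⟨hsrc, hw⟩ := wTrans_fact a₀ ha₀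
  refine ⟨_, hw, ?_⟩
  rw [actWS_apply, hsrc]
  have := no_two hrun h a₀ ha₀; omega

/-- Certificates of a case give a word from a representative. -/
theorem certified {LO HI : List ℕ} {certs : List (List ℕ × ℕ × List ℕ)}
    (hcerts : ∀ e ∈ certs, e.2.1 < 3 ∧ WordOK e.2.2) (hHI : HI.length = 40) (hrun : runCase LO HI certs = true)
    {c : ℕ → ℕ} (hadm : Adm c) (hB : InB LO HI c) :
    ∃ j, j < 3 ∧ ∃ w, WordOK w ∧ Eq40 c (actWS w (repv j)) := by
  obtain ⟨e, he, hce⟩ := runCase_sound certs hHI hrun c hadm hB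
  obtain ⟨hj, hw⟩ := hcerts e he
  refine ⟨e.2.1, hj, e.2.2, hw, fun b hb => ?_⟩
  rw [hce b hb]
  exact actW_getD e.2.2 hw _ (repcL_length _ hj) b hb

/-- Transport of a certificate back along a WLOG word. -/
theorem uncertify {c : ℕ → ℕ} {v : List ℕ} (hv : WordOK v) {j : ℕ} {w : List ℕ} (hw : WordOK w)
    (h : Eq40 (actWS v c) (actWS w (repv j))) : ∃ w', WordOK w' ∧ Eq40 c (actWS w' (repv j)) := by
  refine ⟨w ++ invW v, wordOK_append hw (wordOK_invW hv), fun b hb => ?_⟩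
  rw [actWS_append, ← actWS_invW v hv c b hb]
  exact actWS_congr _ (wordOK_invW hv) h b hb

/-- The conjugation words for the 4-cycle classes. -/
theorem wKap_fact : ∀ a ∈ cyc4L, srcW (wKapC.getD a []) 0 = 0 ∧ srcW (wKapC.getD a []) 1 = a ∧
    WordOK (wKapC.getD a []) := by decide

/-- The conjugation words for the 3-cycle classes. -/
theorem wGam_fact : ∀ a ∈ cyc3L, srcW (wGamC.getD a []) 0 = 0 ∧ srcW (wGamC.getD a []) 5 = a ∧
    WordOK (wGamC.getD a []) ∧ ∀ x ∈ cyc4L, srcW (wGamC.getD a []) x ∈ cyc4L := by decide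

/-- The conjugation words for the transposition classes. -/
theorem wTau_fact : ∀ a ∈ transL, srcW (wTauC.getD a []) 0 = 0 ∧ srcW (wTauC.getD a []) 4 = a ∧
    WordOK (wTauC.getD a []) ∧ (∀ x ∈ cyc4L, srcW (wTauC.getD a []) x ∈ cyc4L) ∧
      ∀ x ∈ cyc3L, srcW (wTauC.getD a []) x ∈ cyc3L := by decide

/-- Digit-bound tables of case `kappa`. -/
theorem bounds_kappa : ∀ b, b < 40 → lo_kappa.getD b 0 = (if b = 0 ∨ b = 1 then 1 else 0) ∧
    hi_kappa.getD b 0 = (if b < 24 then 1 else 2) := by decide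

/-- Digit-bound tables of case `gamma`. -/
theorem bounds_gamma : ∀ b, b < 40 → lo_gamma.getD b 0 = (if b = 0 ∨ b = 5 then 1 else 0) ∧
    hi_gamma.getD b 0 = (if b ∈ cyc4L then 0 else if b < 24 then 1 else 2) := by decide

/-- Digit-bound tables of case `tau`. -/
theorem bounds_tau : ∀ b, b < 40 → lo_tau.getD b 0 = (if b = 0 ∨ b = 4 then 1 else 0) ∧
    hi_tau.getD b 0 = (if b ∈ cyc4L ∨ b ∈ cyc3L then 0 else if b < 24 then 1 else 2) := by decide

/-- The invertible classes are: the identity, 3 double transpositions, 6 four-cycles, 8 three-cycles, 6 transpositions. -/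
theorem inv_classes : ∀ a, a < 24 → a = 0 ∨ a ∈ dblL ∨ a ∈ cyc4L ∨ a ∈ cyc3L ∨ a ∈ transL := by decide

/-- The certificate tables use the three representatives and the five generators. -/
theorem certs_gamma_ok : ∀ e ∈ certs_gamma, e.2.1 < 3 ∧ WordOK e.2.2 := by decide

/-- Digit-bound tables of the four `kappa` sub-cases (classes `4` and `10` fixed). -/
theorem bounds_kappaXY : ∀ b, b < 40 →
    (lo_kappa00.getD b 0 = if b = 4 ∨ b = 10 then 0 else lo_kappa.getD b 0) ∧
    (hi_kappa00.getD b 0 = if b = 4 ∨ b = 10 then 0 else hi_kappa.getD b 0) ∧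
    (lo_kappa01.getD b 0 = if b = 4 then 0 else if b = 10 then 1 else lo_kappa.getD b 0) ∧
    (hi_kappa01.getD b 0 = if b = 4 then 0 else if b = 10 then 1 else hi_kappa.getD b 0) ∧
    (lo_kappa10.getD b 0 = if b = 4 then 1 else if b = 10 then 0 else lo_kappa.getD b 0) ∧
    (hi_kappa10.getD b 0 = if b = 4 then 1 else if b = 10 then 0 else hi_kappa.getD b 0) ∧
    (lo_kappa11.getD b 0 = if b = 4 ∨ b = 10 then 1 else lo_kappa.getD b 0) ∧
    (hi_kappa11.getD b 0 = if b = 4 ∨ b = 10 then 1 else hi_kappa.getD b 0) := by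
  decide

/-- The sub-case tables have 40 entries and certificates in the three representatives / five generators. -/
theorem kappaXY_ok : (hi_kappa00.length = 40 ∧ ∀ e ∈ certs_kappa00, e.2.1 < 3 ∧ WordOK e.2.2) ∧
    (hi_kappa01.length = 40 ∧ ∀ e ∈ certs_kappa01, e.2.1 < 3 ∧ WordOK e.2.2) ∧
    (hi_kappa10.length = 40 ∧ ∀ e ∈ certs_kappa10, e.2.1 < 3 ∧ WordOK e.2.2) ∧
    (hi_kappa11.length = 40 ∧ ∀ e ∈ certs_kappa11, e.2.1 < 3 ∧ WordOK e.2.2) := by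
  decide

/-- The four kernel searches of case `kappa` (split on the digits of classes `4` and `10`). -/
def KappaRuns : Prop :=
  runCase lo_kappa00 hi_kappa00 certs_kappa00 = true ∧ runCase lo_kappa01 hi_kappa01 certs_kappa01 = true ∧
    runCase lo_kappa10 hi_kappa10 certs_kappa10 = true ∧ runCase lo_kappa11 hi_kappa11 certs_kappa11 = true

/-- **Case `kappa` from its four sub-cases.** -/
theorem kappa_split (hK : KappaRuns) {c : ℕ → ℕ} (hadm : Adm c) (hB : InB lo_kappa hi_kappa c)
    (h4 : c 4 ≤ 1) (h10 : c 10 ≤ 1) : ∃ j, j < 3 ∧ ∃ w, WordOK w ∧ Eq40 c (actWS w (repv j)) := by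
  obtain ⟨h00, h01, h10', h11⟩ := hK
  obtain ⟨⟨l00, c00⟩, ⟨l01, c01⟩, ⟨l10, c10⟩, ⟨l11, c11⟩⟩ := kappaXY_ok
  rcases Nat.le_one_iff_eq_zero_or_eq_one.mp h4 with e4 | e4 <;>
    rcases Nat.le_one_iff_eq_zero_or_eq_one.mp h10 with e10 | e10
  · refine certified c00 l00 h00 hadm fun b hb => ?_
    obtain ⟨hl, hh, -⟩ := bounds_kappaXY b hb
    rw [hl, hh]; obtain ⟨hl', hh'⟩ := hB b hb
    constructor <;> split_ifs with h <;> first | (rcases h with rfl | rfl <;> omega) | assumption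
  · refine certified c01 l01 h01 hadm fun b hb => ?_
    obtain ⟨-, -, hl, hh, -⟩ := bounds_kappaXY b hb
    rw [hl, hh]; obtain ⟨hl', hh'⟩ := hB b hb
    constructor <;> split_ifs with h1 h2 <;> first | (subst h1; omega) | (subst h2; omega) | assumption
  · refine certified c10 l10 h10' hadm fun b hb => ?_
    obtain ⟨-, -, -, -, hl, hh, -⟩ := bounds_kappaXY b hb
    rw [hl, hh]; obtain ⟨hl', hh'⟩ := hB b hb
    constructor <;> split_ifs with h1 h2 <;> first | (subst h1; omega) | (subst h2; omega) | assumption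
  · refine certified c11 l11 h11 hadm fun b hb => ?_
    obtain ⟨-, -, -, -, -, -, hl, hh⟩ := bounds_kappaXY b hb
    rw [hl, hh]; obtain ⟨hl', hh'⟩ := hB b hb
    constructor <;> split_ifs with h <;> first | (rcases h with rfl | rfl <;> omega) | assumption

/-- **The enumeration theorem for count vectors** (given the kernel searches): every admissible count vector is
a group image — by a word in the five generators — of one of the three representatives. -/
theorem enum_of_runs (hI : runCase lo_I hi_I certs_I = true) (hK : KappaRuns)
    (hG : runCase lo_gamma hi_gamma certs_gamma = true) (hT : runCase lo_tau hi_tau certs_tau = true)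
    (c : ℕ → ℕ) (h : Adm c) : ∃ j, j < 3 ∧ ∃ w, WordOK w ∧ Eq40 c (actWS w (repv j)) := by
  -- translate: class 0 present once
  obtain ⟨v, hv, hv0⟩ := exists_translate hI h
  set c₁ := actWS v c with hc₁
  have h₁ : Adm c₁ := adm_actWS v hv h
  have one₁ := no_two hI h₁
  suffices H : ∃ j, j < 3 ∧ ∃ w, WordOK w ∧ Eq40 c₁ (actWS w (repv j)) by
    obtain ⟨j, hj, w, hw, he⟩ := H
    exact ⟨j, hj, uncertify hv hw he⟩
  by_cases h4 : ∃ a, a ∈ cyc4L ∧ 1 ≤ c₁ a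
  · -- case kappa
    obtain ⟨a, ha, ha1⟩ := h4
    obtain ⟨hs0, hs1, hw⟩ := wKap_fact a ha
    have h₂ : Adm (actWS (wKapC.getD a []) c₁) := adm_actWS _ hw h₁
    have hB : InB lo_kappa hi_kappa (actWS (wKapC.getD a []) c₁) := fun b hb => by
      obtain ⟨hl, hh⟩ := bounds_kappa b hb
      rw [hl, hh, actWS_apply]
      have hsb := srcW_lt _ hw b hb
      refine ⟨?_, ?_⟩
      · split_ifs with h01
        · rcases h01 with rfl | rfl
          · rw [hs0, hv0]
          · rw [hs1]; exact ha1
        · exact Nat.zero_le _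
      · split_ifs with h24
        · have := no_two hI h₂ b h24; rwa [actWS_apply] at this
        · exact h₁.2.1 _ hsb
    obtain ⟨j, hj, w, hw', he⟩ := kappa_split hK h₂ hB (no_two hI h₂ 4 (by norm_num)) (no_two hI h₂ 10 (by norm_num))
    exact ⟨j, hj, uncertify hw hw' he⟩
  · push Not at h4
    by_cases h3 : ∃ a, a ∈ cyc3L ∧ 1 ≤ c₁ a
    · -- case gamma
      obtain ⟨a, ha, ha1⟩ := h3
      obtain ⟨hs0, hs5, hw, h4c⟩ := wGam_fact a ha
      have h₂ : Adm (actWS (wGamC.getD a []) c₁) := adm_actWS _ hw h₁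
      have hB : InB lo_gamma hi_gamma (actWS (wGamC.getD a []) c₁) := fun b hb => by
        obtain ⟨hl, hh⟩ := bounds_gamma b hb
        rw [hl, hh, actWS_apply]
        have hsb := srcW_lt _ hw b hb
        refine ⟨?_, ?_⟩
        · split_ifs with h05
          · rcases h05 with rfl | rfl
            · rw [hs0, hv0]
            · rw [hs5]; exact ha1
          · exact Nat.zero_le _
        · split_ifs with hc4 h24
          · have := h4 _ (h4c b hc4); omega
          · have := no_two hI h₂ b h24; rwa [actWS_apply] at this
          · exact h₁.2.1 _ hsb
      obtain ⟨j, hj, w, hw', he⟩ := certified certs_gamma_ok hi_lengths.2.2.1 hG h₂ hB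
      exact ⟨j, hj, uncertify hw hw' he⟩
    · push Not at h3
      by_cases h2 : ∃ a, a ∈ transL ∧ 1 ≤ c₁ a
      · -- case tau: empty
        exfalso
        obtain ⟨a, ha, ha1⟩ := h2
        obtain ⟨hs0, hs4, hw, h4c, h3c⟩ := wTau_fact a ha
        have h₂ : Adm (actWS (wTauC.getD a []) c₁) := adm_actWS _ hw h₁
        have hB : InB lo_tau hi_tau (actWS (wTauC.getD a []) c₁) := fun b hb => by
          obtain ⟨hl, hh⟩ := bounds_tau b hb
          rw [hl, hh, actWS_apply]
          have hsb := srcW_lt _ hw b hb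
          refine ⟨?_, ?_⟩
          · split_ifs with h04
            · rcases h04 with rfl | rfl
              · rw [hs0, hv0]
              · rw [hs4]; exact ha1
            · exact Nat.zero_le _
          · split_ifs with hc h24
            · rcases hc with hc | hc
              · have := h4 _ (h4c b hc); omega
              · have := h3 _ (h3c b hc); omega
            · have := no_two hI h₂ b h24; rwa [actWS_apply] at this
            · exact h₁.2.1 _ hsb
        obtain ⟨e, he, -⟩ := runCase_sound certs_tau hi_lengths.2.2.2 hT _ h₂ hB
        simp [certs_tau] at he
      · -- only the identity and double transpositions remain: too few invertible terms
        exfalso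
        push Not at h2
        have hle : bcnt c₁ ≤ ∑ a ∈ range 24, (if a = 0 ∨ a ∈ dblL then 1 else 0) := by
          refine Finset.sum_le_sum fun a ha => ?_
          have ha24 := Finset.mem_range.mp ha
          split_ifs with h0
          · rcases h0 with rfl | hd
            · exact hv0.le
            · exact one₁ a ha24
          · push Not at h0
            rcases inv_classes a ha24 with h | h | h | h | h
            · exact absurd h h0.1
            · exact absurd h h0.2
            · have := h4 a h; omega
            · have := h3 a h; omega
            · have := h2 a h; omega
        have h4' : ∑ a ∈ range 24, (if a = 0 ∨ a ∈ dblL then 1 else 0) = 4 := by decide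
        have := (window c₁ h₁).1
        omega

end Summit.MatrixMultiplication.OmegaCensus.SmallFormats.Enum723
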